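import Literature.Barriers.NavierStokesRegularity.AbstractAPrioriEstimateDirectSumPerSpaceBlocks
import HarnessLib

/-!
# Barrier `AbstractAPrioriEstimateDirectSum` — per-space strengthening, part 2: witnesses, entry, discharge

Part 2 of the per-space form of the T2-a catalogue entry (cell ns-claims, claim C01 `Otelbaev2013`; part 1 =
`AbstractAPrioriEstimateDirectSumPerSpaceBlocks.lean`, the fixed instance `S2` in `ℓ²(Idx, ℝ)` with
(У.1)–(У.5)). Here: the witnesses `ů_n = −w_n(e_{n,f} + e_{n,t})` (`ů_n + L(ů_n,ů_n) = 0`,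
`‖A^{-1}ů_n‖ ≤ 1`, `‖ů_n‖ ≥ w_n = n + 25`), the entry

* `AbstractAPrioriEstimateDirectSumPerSpace` — ONE fixed (infinite-dimensional) instance of the printed
  class (У.1)–(У.5) on which, for every `(C₁, l)`, some `ů` with the weak estimate and `f̊ = 0` has
  `‖ů‖ > C₁(1 + ‖f̊‖ + ‖f̊‖^l)` — so not even SPACE-DEPENDENT constants exist
  [cite: DxdyTopic80156, post 817605 (2014-01-21)];
* `abstractAPrioriEstimateDirectSumPerSpace_holds` — its discharge;
* `not_otelbaev2013_theorem61PerSpace : ¬ Literature.Claims.NS.Otelbaev2013.Theorem61PerSpace` — the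
  referee's charitable retype R#b (constants after the space) fails in the kernel (REF C01, ns-claims-ref-1
  2026-08-26T20:29:59Z: «survives no»; until now print-cited only);
* `not_otelbaev2013_theorem61'` — the printed (uniform) Theorem 6.1 again, via
  `theorem61PerSpace_of_theorem61`.

WHAT THIS IS NOT: not a claim about NS regularity or blow-up; not a claim about any author beyond the
typed locator.
-/

noncomputable section
open scoped RealInnerProductSpace ENNReal
open Literature.Claims.NS.Otelbaev2013 Set Function

namespace Literature.Barriers.NavierStokesRegularity

namespace AbstractAPrioriEstimateDirectSumPerSpace

/-! ### (У.1) -/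

/-- `isPow_iff` — coordinate computation for sup's 2014 `ℓ₂` countermodel to Otelbaev's Theorem 6.1 (all blocks at once, one fixed infinite-dimensional space). [cite: DxdyTopic80156, post 817605 (2014-01-21)] -/
theorem isPow_iff (s : ℝ) (u w : H2) : S2.IsPow s u w ↔ ∀ i, w i = eig2 i ^ s * u i := by
  simp [Setting.IsPow, S2_eig]

/-- `sq_of_isPow_neg_half` — coordinate computation for sup's 2014 `ℓ₂` countermodel to Otelbaev's Theorem 6.1 (all blocks at once, one fixed infinite-dimensional space). [cite: DxdyTopic80156, post 817605 (2014-01-21)] -/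
theorem sq_of_isPow_neg_half {u w : H2} (h : S2.IsPow (-1 / 2) u w) (i : Idx) :
    (u i) ^ 2 = eig2 i * (w i) ^ 2 := by
  rw [isPow_iff] at h
  have ha : 0 < eig2 i := lt_of_lt_of_le one_pos (one_le_eig2 i)
  have hpow : (eig2 i ^ (-1 / 2 : ℝ)) ^ 2 = (eig2 i)⁻¹ := by
    rw [← Real.rpow_natCast, ← Real.rpow_mul ha.le]
    norm_num
    rw [Real.rpow_neg_one]
  have hw : (w i) ^ 2 = (eig2 i)⁻¹ * (u i) ^ 2 := by
    rw [h i, mul_pow, hpow]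
  rw [hw, ← mul_assoc, mul_inv_cancel₀ ha.ne', one_mul]

/-- `sq_apply_le_norm_sq` — coordinate computation for sup's 2014 `ℓ₂` countermodel to Otelbaev's Theorem 6.1 (all blocks at once, one fixed infinite-dimensional space). [cite: DxdyTopic80156, post 817605 (2014-01-21)] -/
theorem sq_apply_le_norm_sq (w : H2) (i : Idx) : (w i) ^ 2 ≤ ‖w‖ ^ 2 := by
  have := abs_apply_le_norm w i
  rw [← sq_abs]; exact pow_le_pow_left₀ (abs_nonneg _) this 2

/-- `eig_prod_le` — coordinate computation for sup's 2014 `ℓ₂` countermodel to Otelbaev's Theorem 6.1 (all blocks at once, one fixed infinite-dimensional space). [cite: DxdyTopic80156, post 817605 (2014-01-21)] -/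
theorem eig_prod_le (n : ℕ) : eig2 (Sum.inr (n, false)) * eig2 (Sum.inr (n, true)) ≤ 8 * (wt n) ^ 2 := by
  rw [eig2_f, eig2_t, wt]
  have : (0 : ℝ) ≤ n := n.cast_nonneg
  nlinarith

/-- `coef_sq_eq` — coordinate computation for sup's 2014 `ℓ₂` countermodel to Otelbaev's Theorem 6.1 (all blocks at once, one fixed infinite-dimensional space). [cite: DxdyTopic80156, post 817605 (2014-01-21)] -/
theorem coef_sq_eq {u v wu wv : H2} (hu : S2.IsPow (-1 / 2) u wu) (hv : S2.IsPow (-1 / 2) v wv) (n : ℕ) :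
    (coef u v n) ^ 2 = (eig2 (Sum.inr (n, false)) * eig2 (Sum.inr (n, true)) / (wt n) ^ 2) *
      ((wu (Sum.inr (n, false))) ^ 2 * (wv (Sum.inr (n, true))) ^ 2) := by
  unfold coef
  rw [div_pow, mul_pow, sq_of_isPow_neg_half hu, sq_of_isPow_neg_half hv]
  ring

/-- `coef_sq_le` — coordinate computation for sup's 2014 `ℓ₂` countermodel to Otelbaev's Theorem 6.1 (all blocks at once, one fixed infinite-dimensional space). [cite: DxdyTopic80156, post 817605 (2014-01-21)] -/
theorem coef_sq_le {u v wu wv : H2} (hu : S2.IsPow (-1 / 2) u wu) (hv : S2.IsPow (-1 / 2) v wv) (n : ℕ) :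
    (coef u v n) ^ 2 ≤ 8 * ((wu (Sum.inr (n, false))) ^ 2 * (wv (Sum.inr (n, true))) ^ 2) := by
  rw [coef_sq_eq hu hv]
  have hw : 0 < (wt n) ^ 2 := pow_pos (wt_pos n) 2
  have hratio : eig2 (Sum.inr (n, false)) * eig2 (Sum.inr (n, true)) / (wt n) ^ 2 ≤ 8 := by
    rw [div_le_iff₀ hw]; exact eig_prod_le n
  exact mul_le_mul_of_nonneg_right hratio (by positivity)

/-- `Lsq_le_dom` — coordinate computation for sup's 2014 `ℓ₂` countermodel to Otelbaev's Theorem 6.1 (all blocks at once, one fixed infinite-dimensional space). [cite: DxdyTopic80156, post 817605 (2014-01-21)] -/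
theorem Lsq_le_dom {u v wu wv : H2} (hu : S2.IsPow (-1 / 2) u wu) (hv : S2.IsPow (-1 / 2) v wv) (i : Idx) :
    (S2.L u v i) ^ 2 ≤ 8 * ‖wv‖ ^ 2 * (wu i) ^ 2 + 8 * ‖wu‖ ^ 2 * (wv i) ^ 2 := by
  rcases i with k | ⟨n, b⟩
  · rw [S2_L_inl]
    have : (0 : ℝ) ^ 2 = 0 := by norm_num
    rw [this]; positivity
  · rw [S2_L_inr]
    have hc := coef_sq_le hu hv n
    have t1 : 0 ≤ 8 * ‖wv‖ ^ 2 * (wu (Sum.inr (n, b))) ^ 2 := by positivity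
    have t2 : 0 ≤ 8 * ‖wu‖ ^ 2 * (wv (Sum.inr (n, b))) ^ 2 := by positivity
    cases b
    · have hv' := sq_apply_le_norm_sq wv (Sum.inr (n, true))
      have : 8 * ((wu (Sum.inr (n, false))) ^ 2 * (wv (Sum.inr (n, true))) ^ 2) ≤
          8 * ‖wv‖ ^ 2 * (wu (Sum.inr (n, false))) ^ 2 := by
        nlinarith [sq_nonneg (wu (Sum.inr (n, false)))]
      linarith
    · have hu' := sq_apply_le_norm_sq wu (Sum.inr (n, false))
      have : 8 * ((wu (Sum.inr (n, false))) ^ 2 * (wv (Sum.inr (n, true))) ^ 2) ≤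
          8 * ‖wu‖ ^ 2 * (wv (Sum.inr (n, true))) ^ 2 := by
        nlinarith [sq_nonneg (wv (Sum.inr (n, true)))]
      linarith

/-- `S2_y1` — coordinate computation for sup's 2014 `ℓ₂` countermodel to Otelbaev's Theorem 6.1 (all blocks at once, one fixed infinite-dimensional space). [cite: DxdyTopic80156, post 817605 (2014-01-21)] -/
theorem S2_y1 : S2.Y1 (-1 / 2) 4 := by
  refine ⟨fun i => one_le_eig2 i, fun u v wu wv hu hv => ?_⟩
  have hdom : Summable fun i => 8 * ‖wv‖ ^ 2 * (wu i) ^ 2 + 8 * ‖wu‖ ^ 2 * (wv i) ^ 2 :=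
    ((summable_sq wu).mul_left _).add ((summable_sq wv).mul_left _)
  have hsq : ‖S2.L u v‖ ^ 2 ≤ 16 * (‖wu‖ ^ 2 * ‖wv‖ ^ 2) := by
    rw [norm_sq_eq_tsum]
    calc ∑' i, (S2.L u v i) ^ 2 ≤ ∑' i, (8 * ‖wv‖ ^ 2 * (wu i) ^ 2 + 8 * ‖wu‖ ^ 2 * (wv i) ^ 2) :=
          (summable_sq _).tsum_le_tsum (Lsq_le_dom hu hv) hdom
      _ = 8 * ‖wv‖ ^ 2 * ∑' i, (wu i) ^ 2 + 8 * ‖wu‖ ^ 2 * ∑' i, (wv i) ^ 2 := by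
          rw [((summable_sq wu).mul_left _).tsum_add ((summable_sq wv).mul_left _), tsum_mul_left,
            tsum_mul_left]
      _ = 16 * (‖wu‖ ^ 2 * ‖wv‖ ^ 2) := by rw [← norm_sq_eq_tsum, ← norm_sq_eq_tsum]; ring
  have h0 : 0 ≤ 4 * ‖wu‖ * ‖wv‖ := by positivity
  have : ‖S2.L u v‖ ^ 2 ≤ (4 * ‖wu‖ * ‖wv‖) ^ 2 := by nlinarith
  exact (pow_le_pow_iff_left₀ (norm_nonneg _) h0 two_ne_zero).1 this


/-! ### the witness family -/

/-- Basis vector `e_{n,f}` of block `n`. [folklore] -/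
def ef (n : ℕ) : H2 := lp.single 2 (Sum.inr (n, false) : Idx) (1 : ℝ)
/-- Basis vector `e_{n,t}` of block `n`. [folklore] -/
def et (n : ℕ) : H2 := lp.single 2 (Sum.inr (n, true) : Idx) (1 : ℝ)

/-- `ef_apply` — coordinate computation for sup's 2014 `ℓ₂` countermodel to Otelbaev's Theorem 6.1 (all blocks at once, one fixed infinite-dimensional space). [cite: DxdyTopic80156, post 817605 (2014-01-21)] -/
theorem ef_apply (n : ℕ) (i : Idx) : ef n i = if i = Sum.inr (n, false) then 1 else 0 := by
  unfold ef; rw [lp.single_apply, Pi.single_apply]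

/-- `et_apply` — coordinate computation for sup's 2014 `ℓ₂` countermodel to Otelbaev's Theorem 6.1 (all blocks at once, one fixed infinite-dimensional space). [cite: DxdyTopic80156, post 817605 (2014-01-21)] -/
theorem et_apply (n : ℕ) (i : Idx) : et n i = if i = Sum.inr (n, true) then 1 else 0 := by
  unfold et; rw [lp.single_apply, Pi.single_apply]

/-- The witness `ů_n = −w_n (e_{n,f} + e_{n,t})`: `ů_n + L(ů_n,ů_n) = 0`, `‖ů_n‖ ≥ w_n → ∞`. [folklore] -/
def uW (n : ℕ) : H2 := (-(wt n)) • (ef n + et n)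

/-- `uW_apply` — coordinate computation for sup's 2014 `ℓ₂` countermodel to Otelbaev's Theorem 6.1 (all blocks at once, one fixed infinite-dimensional space). [cite: DxdyTopic80156, post 817605 (2014-01-21)] -/
theorem uW_apply (n : ℕ) (i : Idx) :
    uW n i = -(wt n) * ((if i = Sum.inr (n, false) then 1 else 0) + (if i = Sum.inr (n, true) then 1 else 0)) := by
  simp only [uW, lp.coeFn_smul, lp.coeFn_add, Pi.smul_apply, Pi.add_apply, ef_apply, et_apply, smul_eq_mul]

/-- `uW_f` — coordinate computation for sup's 2014 `ℓ₂` countermodel to Otelbaev's Theorem 6.1 (all blocks at once, one fixed infinite-dimensional space). [cite: DxdyTopic80156, post 817605 (2014-01-21)] -/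
theorem uW_f (n : ℕ) : uW n (Sum.inr (n, false)) = -(wt n) := by rw [uW_apply]; simp
/-- `uW_t` — coordinate computation for sup's 2014 `ℓ₂` countermodel to Otelbaev's Theorem 6.1 (all blocks at once, one fixed infinite-dimensional space). [cite: DxdyTopic80156, post 817605 (2014-01-21)] -/
theorem uW_t (n : ℕ) : uW n (Sum.inr (n, true)) = -(wt n) := by rw [uW_apply]; simp
/-- `uW_other` — coordinate computation for sup's 2014 `ℓ₂` countermodel to Otelbaev's Theorem 6.1 (all blocks at once, one fixed infinite-dimensional space). [cite: DxdyTopic80156, post 817605 (2014-01-21)] -/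
theorem uW_other (n : ℕ) {i : Idx} (h1 : i ≠ Sum.inr (n, false)) (h2 : i ≠ Sum.inr (n, true)) :
    uW n i = 0 := by rw [uW_apply]; simp [h1, h2]

/-- `coef_uW` — coordinate computation for sup's 2014 `ℓ₂` countermodel to Otelbaev's Theorem 6.1 (all blocks at once, one fixed infinite-dimensional space). [cite: DxdyTopic80156, post 817605 (2014-01-21)] -/
theorem coef_uW (n : ℕ) : coef (uW n) (uW n) n = wt n := by
  unfold coef; rw [uW_f, uW_t]; have := wt_pos n; field_simp

/-- `coef_uW_ne` — coordinate computation for sup's 2014 `ℓ₂` countermodel to Otelbaev's Theorem 6.1 (all blocks at once, one fixed infinite-dimensional space). [cite: DxdyTopic80156, post 817605 (2014-01-21)] -/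
theorem coef_uW_ne (n m : ℕ) (h : m ≠ n) : coef (uW n) (uW n) m = 0 := by
  unfold coef
  rw [uW_other n (by simp [h]) (by simp [h])]; simp

/-- `nl_uW` — coordinate computation for sup's 2014 `ℓ₂` countermodel to Otelbaev's Theorem 6.1 (all blocks at once, one fixed infinite-dimensional space). [cite: DxdyTopic80156, post 817605 (2014-01-21)] -/
theorem nl_uW (n : ℕ) : S2.nl (uW n) = 0 := by
  apply lp.ext; funext i
  show (uW n + S2.L (uW n) (uW n)) i = 0
  rw [lp.coeFn_add, Pi.add_apply]
  rcases i with k | ⟨m, b⟩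
  · rw [S2_L_inl, uW_other n (by simp) (by simp)]; simp
  · rw [S2_L_inr]
    by_cases hm : m = n
    · subst hm
      rw [coef_uW]
      cases b
      · rw [uW_f]; simp
      · rw [uW_t]; simp
    · rw [coef_uW_ne n m hm, uW_other n (by simp [hm]) (by simp [hm])]; simp

/-- `A^{-1}ů_n = −(w_n/λ_{n,f}) e_{n,f} − (w_n/λ_{n,t}) e_{n,t}` (norm `≤ 1`). [folklore] -/
def wW (n : ℕ) : H2 := (-(wt n) / (50 + 2 * n)) • ef n + (-(wt n) / (51 + 2 * n)) • et n

/-- `wW_apply` — coordinate computation for sup's 2014 `ℓ₂` countermodel to Otelbaev's Theorem 6.1 (all blocks at once, one fixed infinite-dimensional space). [cite: DxdyTopic80156, post 817605 (2014-01-21)] -/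
theorem wW_apply (n : ℕ) (i : Idx) :
    wW n i = (-(wt n) / (50 + 2 * n)) * (if i = Sum.inr (n, false) then 1 else 0) +
      (-(wt n) / (51 + 2 * n)) * (if i = Sum.inr (n, true) then 1 else 0) := by
  simp only [wW, lp.coeFn_smul, lp.coeFn_add, Pi.smul_apply, Pi.add_apply, ef_apply, et_apply, smul_eq_mul]

/-- `weakEstimate_uW` — coordinate computation for sup's 2014 `ℓ₂` countermodel to Otelbaev's Theorem 6.1 (all blocks at once, one fixed infinite-dimensional space). [cite: DxdyTopic80156, post 817605 (2014-01-21)] -/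
theorem weakEstimate_uW (n : ℕ) : S2.WeakEstimate (-1) 1 (uW n) := by
  refine ⟨wW n, ?_, ?_⟩
  · rw [isPow_iff]
    intro i
    rw [Real.rpow_neg_one, wW_apply, uW_apply]
    rcases i with k | ⟨m, b⟩
    · simp
    · by_cases hm : m = n
      · subst hm
        cases b
        · simp [eig2_f]; ring
        · simp [eig2_t]; ring
      · simp [hm]
  · -- ‖w‖² = (w/(50+2n))² + (w/(51+2n))² ≤ 1/4 + 1/4
    have hsq : ‖wW n‖ ^ 2 ≤ 1 := by
      rw [norm_sq_eq_tsum]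
      have hsupp : ∀ i, i ∉ ({Sum.inr (n, false), Sum.inr (n, true)} : Finset Idx) → (wW n i) ^ 2 = 0 := by
        intro i hi
        simp only [Finset.mem_insert, Finset.mem_singleton, not_or] at hi
        rw [wW_apply]; simp [hi.1, hi.2]
      rw [tsum_eq_sum hsupp, Finset.sum_pair (by simp)]
      rw [wW_apply, wW_apply]
      simp
      have hw : wt n = n + 25 := rfl
      have h1 : (-(wt n) / (50 + 2 * n)) ^ 2 = 1 / 4 := by
        rw [hw]; have : (50 + 2 * (n:ℝ)) = 2 * (n + 25) := by ring
        rw [this]; have hp : (0:ℝ) < n + 25 := by positivity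
        field_simp; ring
      have h2 : (-(wt n) / (51 + 2 * n)) ^ 2 ≤ 1 / 4 := by
        rw [hw, div_pow, neg_sq, div_le_iff₀ (by positivity)]
        have : (0:ℝ) ≤ n := n.cast_nonneg
        nlinarith
      linarith
    nlinarith [norm_nonneg (wW n)]

/-- `norm_uW` — coordinate computation for sup's 2014 `ℓ₂` countermodel to Otelbaev's Theorem 6.1 (all blocks at once, one fixed infinite-dimensional space). [cite: DxdyTopic80156, post 817605 (2014-01-21)] -/
theorem norm_uW (n : ℕ) : wt n ≤ ‖uW n‖ := by
  have h := abs_apply_le_norm (uW n) (Sum.inr (n, false))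
  rw [uW_f, abs_neg, abs_of_pos (wt_pos n)] at h
  exact h

/-! ### the per-space reading fails in `ℓ²` -/

/-- `not_otelbaev2013_theorem61PerSpace` — coordinate computation for sup's 2014 `ℓ₂` countermodel to Otelbaev's Theorem 6.1 (all blocks at once, one fixed infinite-dimensional space). [cite: DxdyTopic80156, post 817605 (2014-01-21)] -/
theorem not_perSpace_S2 : ¬ Theorem61PerSpace := by
  intro h
  obtain ⟨C₁, l, hC⟩ := h Idx H2 S2 (-1 / 2) 4 (-1) 1 (by norm_num) (by norm_num) (by norm_num)
    S2_y1 S2_y2 S2_y3 S2_y4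
  -- pick n with wt n > 2|C₁|
  obtain ⟨n, hn⟩ := exists_nat_gt (2 * |C₁|)
  have hb := hC (uW n) (weakEstimate_uW n)
  rw [nl_uW, norm_zero] at hb
  have h0l : (0 : ℝ) ^ l ≤ 1 := by
    rcases eq_or_ne l 0 with h | h
    · rw [h, Real.rpow_zero]
    · rw [Real.zero_rpow h]; norm_num
  have h0l' : 0 ≤ (0 : ℝ) ^ l := Real.rpow_nonneg le_rfl _
  have hwt : (n : ℝ) + 25 ≤ ‖uW n‖ := norm_uW n
  have : C₁ * (1 + 0 + (0 : ℝ) ^ l) ≤ 2 * |C₁| := by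
    calc C₁ * (1 + 0 + (0 : ℝ) ^ l) ≤ |C₁| * (1 + 0 + (0 : ℝ) ^ l) :=
          mul_le_mul_of_nonneg_right (le_abs_self _) (by linarith)
      _ ≤ |C₁| * 2 := mul_le_mul_of_nonneg_left (by linarith) (abs_nonneg _)
      _ = 2 * |C₁| := by ring
  linarith


end AbstractAPrioriEstimateDirectSumPerSpace

open AbstractAPrioriEstimateDirectSumPerSpace

/-- **Barrier (T2-a, per-space form): one fixed infinite-dimensional instance of the printed class
(У.1)–(У.5) of Otelbaev 2013 §6 — `ℓ²` with sup's blocks — on which for EVERY `(C₁, l)` there is `ů`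
with the weak estimate `‖A^{-1}ů‖ ≤ 1`, `f̊ = ů + L(ů,ů) = 0` and `‖ů‖ > C₁(1 + ‖f̊‖ + ‖f̊‖^l)`.**
Hence no a priori bound of the printed shape holds even with constants chosen AFTER the space
(the charitable reading `Theorem61PerSpace`), as soon as the space is infinite-dimensional.
[cite: DxdyTopic80156, post 817605 (2014-01-21)]

BARRIER (structured block, D-0021):
technique_class: abstract-operator-theorem spectral-hypotheses bilinear-smoothing-bound a-priori-estimate weak-to-strong-estimate per-space-constants hilbert-space-navier-stokes-type
blocks: the charitable PER-SPACE repair of dimension-uniform abstract a priori estimates of the (У.1)–(У.5) type (constants allowed to depend on `(Ĥ, A, L)`), in any infinite-dimensional space; adjudicated instance: claim C01 `Otelbaev2013`, retype `Literature.Claims.NS.Otelbaev2013.Theorem61PerSpace` of Thm 6.1 p.29 (REF C01 ns-claims-ref-1 2026-08-26T20:29:59Z, R#b) [cite: Otelbaev2013, Thm 6.1 p.29 and p.62].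
because: in the fixed space `ℓ²` the hypotheses hold once and the witnesses `ů_n = −(n+25)(e_{n,f}+e_{n,t})` have `f̊ = 0`, `‖A^{-1}ů_n‖ ≤ 1`, `‖ů_n‖ → ∞` — kernel theorems `abstractAPrioriEstimateDirectSumPerSpace_holds`, `not_otelbaev2013_theorem61PerSpace` [cite: DxdyTopic80156, post 817605 (2014-01-21)]; the finite-dimensional (uniform) form is the sibling entry `AbstractAPrioriEstimateDirectSum`.
evasions_known: in a FIXED FINITE-dimensional space the per-space bound is trivially true with a dimension-dependent constant (Otelbaev 2013 p.62) — useless for the printed chain, whose §7 instance `Ĥ = L²(0,a;H)` is infinite-dimensional [cite: Otelbaev2013, p.62 and Lemma 7.15 p.84]; otherwise as for the sibling entry (hypotheses seeing equation-specific structure) [cite: Tao2016AveragedNS, §1.1 p.8].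
scope_caveats: (i) constants `(β, C_β, θ, C_θ) = (−1/2, 4, −1, 1)` as in the 2014 post; (ii) the instance is stated for the concrete space `ℓ²(Fin 50 ⊕ ℕ × Bool, ℝ)` (plumbing defs `Idx`, `H2` of part 1), an `Otelbaev2013.Setting` in the cell's typing of (У.1)–(У.5); (iii) says nothing about Theorem 2 (I) (Conditions B1–B4 at NS scaling).
status: established -/
def AbstractAPrioriEstimateDirectSumPerSpace : Prop :=
  ∃ S : Setting Idx H2,
    S.Y1 (-1 / 2) 4 ∧ S.Y2 ∧ S.Y3 ∧ S.Y4 ∧ (∀ n CP : ℝ, 0 ≤ n → 0 < CP → S.Y5 n CP) ∧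
      ∀ C₁ l : ℝ, ∃ u : H2,
        S.WeakEstimate (-1) 1 u ∧ S.nl u = 0 ∧ C₁ * (1 + ‖S.nl u‖ + ‖S.nl u‖ ^ l) < ‖u‖

/-- **Discharge**: the instance `S2` with the witnesses `uW n`, `n > 2|C₁|`.
[cite: DxdyTopic80156, post 817605 (2014-01-21)] -/
theorem abstractAPrioriEstimateDirectSumPerSpace_holds : AbstractAPrioriEstimateDirectSumPerSpace := by
  refine ⟨S2, S2_y1, S2_y2, S2_y3, S2_y4, fun n CP hn hCP => S2_y5 hn hCP, fun C₁ l => ?_⟩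
  obtain ⟨n, hn⟩ := exists_nat_gt (2 * |C₁|)
  refine ⟨uW n, weakEstimate_uW n, nl_uW n, ?_⟩
  rw [nl_uW, norm_zero]
  have h0l : (0 : ℝ) ^ l ≤ 1 := by
    rcases eq_or_ne l 0 with h | h
    · rw [h, Real.rpow_zero]
    · rw [Real.zero_rpow h]; norm_num
  have h0l' : 0 ≤ (0 : ℝ) ^ l := Real.rpow_nonneg le_rfl _
  have hwt : (n : ℝ) + 25 ≤ ‖uW n‖ := norm_uW n
  have : C₁ * (1 + 0 + (0 : ℝ) ^ l) ≤ 2 * |C₁| := by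
    calc C₁ * (1 + 0 + (0 : ℝ) ^ l) ≤ |C₁| * (1 + 0 + (0 : ℝ) ^ l) :=
          mul_le_mul_of_nonneg_right (le_abs_self _) (by linarith)
      _ ≤ |C₁| * 2 := mul_le_mul_of_nonneg_left (by linarith) (abs_nonneg _)
      _ = 2 * |C₁| := by ring
  linarith

/-- **The per-space (charitable) reading of Otelbaev's Theorem 6.1 is false**: the referee's retype R#b
`Theorem61PerSpace` (constants may depend on `(Ĥ, A, L)`) fails on the fixed space `ℓ²` — kernel version
of «sup»'s 21.01.2014 post. [cite: DxdyTopic80156, post 817605 (2014-01-21)] -/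
theorem not_otelbaev2013_theorem61PerSpace : ¬ Theorem61PerSpace := not_perSpace_S2

/-- The printed (uniform) Theorem 6.1 is refuted once more through its per-space consequence
(`theorem61PerSpace_of_theorem61`). [cite: DxdyTopic80156, post 817605 (2014-01-21)] -/
theorem not_otelbaev2013_theorem61' : ¬ Theorem61 :=
  fun h => not_otelbaev2013_theorem61PerSpace (theorem61PerSpace_of_theorem61 h)

end Literature.Barriers.NavierStokesRegularity

end
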